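import Summits.Ventures.PercRepro.RankLevelSetBiIndepContainSkew
import Summits.Ventures.PercRepro.RankLevelSetBiIndepLRPaving
import Summits.Ventures.PercRepro.RankLevelSetBiIndepPerElemModel

/-! # RankLevelSetBiIndepContainSkewPaving — EVERY PAVING MATROID SATISFIES THE CONTAIN-X SKEWNESS (CX*) AND THE
CONTAIN-X MONOTONICITY (CX) (night-1 g28; dossier §40.12)

In a paving matroid (every set smaller than the rank is independent) the contain-`X` profile `α^X_k = #{Z ∈ D_k : X ⊆ Z}`
is the full binomial row `C(#E − #X, k − #X)` at every level `k` whose sets and complements are both below the rank.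
If `α^X_k ≠ 0` then `#E − k ≤ rank`, so both `m = #E − 1 − k` and `k + 1` (for `2k + 1 < #E`) are below the rank and the
`m`-level is a full row, while `α^X_k ≤ C(#E − #X, k − #X)`; the binomial unimodality `C(N, a) ≤ C(N, b)` for
`a ≤ b ≤ N − a` (the cell's `choose_le_choose_of_le_of_le_sub`) gives **`biContainSkew_of_paving : Paving M →`
`BiContainSkew M`**, and the same argument at consecutive levels gives **`biContainMono_of_paving : Paving M →`
`BiContainMono M`** — the first member class of (CX*)/(CX) in the kernel. (The minors of a paving matroid need not be
paving, so this does not by itself feed the minor-closed hypothesis of `biIndepPerElem_of_biContainSkew`; (★★) for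
paving matroids is the cell's `biIndepPerElem_of_paving`.) Every declaration has a docstring; imports: the cell's own
modules and Mathlib only. Axioms: standard. -/

namespace PercRepro

open Set Matroid

variable {α : Type} (M : Matroid α) [M.Finite]

/-! ## Counting the supersets of `X` -/

omit [M.Finite] in
/-- **The `k`-subsets of a finite set `E` containing `X ⊆ E`** number `C(#E − #X, k − #X)` (for `#X ≤ k`), by
`Z ↦ Z ∖ X`. -/
lemma ncard_supersets_of_finite {E X : Set α} (hE : E.Finite) (hX : X ⊆ E) {k : ℕ} (hk : X.ncard ≤ k) :
    {Z : Set α | Z ⊆ E ∧ Z.ncard = k ∧ X ⊆ Z}.ncard = (E.ncard - X.ncard).choose (k - X.ncard) := by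
  have hEX : (E \ X).Finite := hE.subset Set.sdiff_subset
  have hXfin : X.Finite := hE.subset hX
  rw [← Set.ncard_sdiff' hX hE, ← ncard_subsets_of_finite hEX (k - X.ncard)]
  refine Set.ncard_congr (fun Z _ => Z \ X) ?_ ?_ ?_
  · rintro Z ⟨hZE, hZcard, hXZ⟩
    refine ⟨Set.sdiff_subset_sdiff_left hZE, ?_⟩
    rw [Set.ncard_sdiff' hXZ (hE.subset hZE), hZcard]
  · rintro Z Z' ⟨-, -, hXZ⟩ ⟨-, -, hXZ'⟩ h
    have h1 : Z = Z \ X ∪ X := (Set.sdiff_union_of_subset hXZ).symm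
    have h2 : Z' = Z' \ X ∪ X := (Set.sdiff_union_of_subset hXZ').symm
    rw [h1, h2, h]
  · rintro Y ⟨hYE, hYcard⟩
    have hYfin : Y.Finite := hEX.subset hYE
    have hdisj : Disjoint Y X := by
      rw [Set.disjoint_left]
      intro x hxY hxX
      exact (hYE hxY).2 hxX
    refine ⟨Y ∪ X, ⟨Set.union_subset (hYE.trans Set.sdiff_subset) hX, ?_, Set.subset_union_right⟩, ?_⟩
    · rw [Set.ncard_union_eq hdisj hYfin hXfin, hYcard]; omega
    · rw [Set.union_sdiff_right]
      exact sdiff_eq_left.mpr hdisj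

/-! ## The contain-`X` profile of a paving matroid -/

omit [M.Finite] in
/-- `α^X_k ≤ C(#E − #X, k − #X)` for `#X ≤ k` (every bi-independent set containing `X` is a superset of `X`). -/
lemma biContainCount_le_choose [M.Finite] {X : Set α} (hX : X ⊆ M.E) {k : ℕ} (hk : X.ncard ≤ k) :
    biContainCount M X k ≤ (M.E.ncard - X.ncard).choose (k - X.ncard) := by
  rw [← ncard_supersets_of_finite M.ground_finite hX hk]
  unfold biContainCount biIndep
  refine Set.ncard_le_ncard ?_ (M.ground_finite.finite_subsets.subset (fun Z hZ => hZ.1))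
  rintro Z ⟨⟨hZE, hZcard, -, -⟩, hXZ⟩
  exact ⟨hZE, hZcard, hXZ⟩

/-- **The full row**: in a paving matroid, if `k < rank` and `#E − k < rank` then every `k`-superset of `X` is
bi-independent: `α^X_k = C(#E − #X, k − #X)`. -/
lemma biContainCount_eq_choose_of_paving (h : Paving M) {X : Set α} (hX : X ⊆ M.E) {k : ℕ} (hk : X.ncard ≤ k)
    (hk1 : ((k : ℕ) : ℕ∞) < M.eRank) (hk2 : ((M.E.ncard - k : ℕ) : ℕ∞) < M.eRank) :
    biContainCount M X k = (M.E.ncard - X.ncard).choose (k - X.ncard) := by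
  rw [← ncard_supersets_of_finite M.ground_finite hX hk]
  unfold biContainCount biIndep
  congr 1
  ext Z
  simp only [Set.mem_setOf_eq]
  constructor
  · rintro ⟨⟨hZE, hZcard, -, -⟩, hXZ⟩
    exact ⟨hZE, hZcard, hXZ⟩
  · rintro ⟨hZE, hZcard, hXZ⟩
    have hZfin : Z.Finite := M.ground_finite.subset hZE
    refine ⟨⟨hZE, hZcard, ?_, ?_⟩, hXZ⟩
    · refine paving_indep_of_encard_lt M h hZE ?_
      rw [← Set.Finite.cast_ncard_eq hZfin, hZcard]
      exact hk1
    · refine paving_indep_of_encard_lt M h Set.sdiff_subset ?_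
      rw [← Set.Finite.cast_ncard_eq (M.ground_finite.subset Set.sdiff_subset), Set.ncard_sdiff' hZE M.ground_finite,
        hZcard]
      exact hk2

/-- A nonzero `α^X_k` forces `#X ≤ k` and `#E − k ≤ rank` (a bi-independent `k`-set contains `X` and has an
independent complement). -/
lemma of_biContainCount_ne_zero {X : Set α} {k : ℕ} (hne : biContainCount M X k ≠ 0) :
    X.ncard ≤ k ∧ ((M.E.ncard - k : ℕ) : ℕ∞) ≤ M.eRank := by
  obtain ⟨Z, hZ, hXZ⟩ := Set.nonempty_of_ncard_ne_zero hne
  have hZfin : Z.Finite := M.ground_finite.subset hZ.1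
  refine ⟨?_, biIndep_compl_encard_le_eRank M hZ⟩
  rw [← hZ.2.1]
  exact Set.ncard_le_ncard hXZ hZfin

/-! ## (CX*) and (CX) for paving matroids -/

/-- **EVERY PAVING MATROID SATISFIES (CX*)**: `Paving M → BiContainSkew M`. -/
theorem biContainSkew_of_paving (h : Paving M) : BiContainSkew M := by
  intro X hX k hk
  by_cases hzero : biContainCount M X k = 0
  · rw [hzero]; exact Nat.zero_le _
  obtain ⟨hck, hrank⟩ := of_biContainCount_ne_zero M hzero
  set m := M.E.ncard - 1 - k with hm
  have hm1 : ((m : ℕ) : ℕ∞) < M.eRank :=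
    lt_of_lt_of_le (by exact_mod_cast (show m < M.E.ncard - k by omega)) hrank
  have hm2 : ((M.E.ncard - m : ℕ) : ℕ∞) < M.eRank :=
    lt_of_lt_of_le (by exact_mod_cast (show M.E.ncard - m < M.E.ncard - k by omega)) hrank
  calc biContainCount M X k ≤ (M.E.ncard - X.ncard).choose (k - X.ncard) := biContainCount_le_choose M hX hck
    _ ≤ (M.E.ncard - X.ncard).choose (m - X.ncard) :=
        choose_le_choose_of_le_of_le_sub (by omega) (by omega)
    _ = biContainCount M X m := (biContainCount_eq_choose_of_paving M h hX (by omega) hm1 hm2).symm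

/-- **EVERY PAVING MATROID SATISFIES (CX)**: `Paving M → BiContainMono M`. -/
theorem biContainMono_of_paving (h : Paving M) : BiContainMono M := by
  intro X hX k hk
  by_cases hzero : biContainCount M X k = 0
  · rw [hzero]; exact Nat.zero_le _
  obtain ⟨hck, hrank⟩ := of_biContainCount_ne_zero M hzero
  have hk1 : (((k + 1 : ℕ)) : ℕ∞) < M.eRank :=
    lt_of_lt_of_le (by exact_mod_cast (show k + 1 < M.E.ncard - k by omega)) hrank
  have hk2 : ((M.E.ncard - (k + 1) : ℕ) : ℕ∞) < M.eRank :=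
    lt_of_lt_of_le (by exact_mod_cast (show M.E.ncard - (k + 1) < M.E.ncard - k by omega)) hrank
  calc biContainCount M X k ≤ (M.E.ncard - X.ncard).choose (k - X.ncard) := biContainCount_le_choose M hX hck
    _ ≤ (M.E.ncard - X.ncard).choose (k + 1 - X.ncard) :=
        choose_le_choose_of_le_of_le_sub (by omega) (by omega)
    _ = biContainCount M X (k + 1) := (biContainCount_eq_choose_of_paving M h hX (by omega) hk1 hk2).symm

/-- The middle step of (CX) for paving matroids. -/
theorem biContainMonoMid_of_paving (h : Paving M) : BiContainMonoMid M :=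
  biContainMonoMid_of_biContainMono M (biContainMono_of_paving M h)

end PercRepro
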